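import Literature.Topology.FourManifolds.SmaleStraightening
import Literature.Topology.FourManifolds.AmbientIsotopyLevelSuspension
import Literature.Topology.PlaneTopology.JordanCurve
import Mathlib.Analysis.InnerProductSpace.Calculus
import Mathlib.Analysis.SpecialFunctions.Complex.LogDeriv
import HarnessLib

/-!
# Smale's theorem: `π₀ Diff(D² rel ∂) = 0` — every compactly supported diffeomorphism of the plane is diffeotopic to the identity

Topic `Literature/Topology/FourManifolds`. S. Smale, *Diffeomorphisms of the 2-sphere*, Proc.
AMS 10 (1959) 621–626, Thm. B (the space of diffeomorphisms of the square equal to the identity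
near the boundary is contractible; here its `π₀`); J. Cerf, *Sur les difféomorphismes de la
sphère de dimension trois (Γ₄ = 0)*, LNM 53 (1968), Appendice §5, Théorème 4 ("le théorème de
Smale": the group `𝒦` of diffeomorphisms of `D²` infinitely tangent to the identity along `S¹`
has `π_i(𝒦) = 0`; here `i = 0`), in the tree's model
`Literature.Topology.FourManifolds.UnitBallDiffeotopyTrivial` (`DiffeotopyTransport.lean`):

* `unitBallDiffeotopyTrivial_complex`, `unitBallDiffeotopyTrivial_euclideanSpace_two` — **every
  diffeomorphism of `ℝ²` which is the identity off the unit disc is the time-one stage of a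
  diffeotopy all of whose stages are the identity off the unit disc** (PROVED). This makes the
  tree's `n = 2` instances of Cerf's Proposition 4 unconditional: every diffeomorphism of `S²` is
  diffeotopic to the identity or to a reflection
  (`Diffeomorph.isDiffeotopicToId_or_isDiffeotopic_sphereReflection_two`), `Γ₃ = 0`
  (`extendsOverBall_two`), and every twisted `3`-sphere `D³ ∪_φ D³` is diffeomorphic to `S³`
  (`TwistedSphere.nonempty_diffeomorph_sphere_three`).

## Smale's proof, as formalised

Let `s` be a diffeomorphism of `ℂ` equal to the identity off the closed unit disc, `g = s⁻¹`,
`F = Im ∘ g` (a function without critical points, equal to `Im` off the disc) and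
`X₁ = -i ∇F/‖∇F‖` the unit field along the level curves of `F`, equal to `1` off the disc. Since
`ℂ` is simply connected, `X₁ = exp Θ` with `Θ` smooth, purely imaginary and `0` off the disc
(`exists_angle_of_diffeomorph`). The straightening isotopy `E_τ` of the fields `exp (χ(τ) Θ)`
(`SmaleStraightening.lean`, with the Poincaré–Bendixson/Umlaufsatz input of
`PlanarFlowEscape.lean` and `SmoothUmlaufsatz.lean`) is corrected by two families of shears
(`x ↦ x + β(x) a_τ(c)` on the rows, `c ↦ c + β(x) (k_τ(c) - c)` on the columns, read off from the
inverse stages on the line `Re = 5`; fibred maps with positive pivot are diffeomorphisms,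
`bijective_isLocalDiffeomorph_add_smul`) into a compactly supported ambient isotopy `Φ_τ` with
`Φ₀ = id` and `F ∘ Φ₁ = Im`. Hence `u = g ∘ Φ₁` preserves every horizontal line, so is reached
by the straight-line diffeotopy (fibrewise convexity,
`exists_compactDiffeotopy_of_forall_sub_mem_span`, `UnitBallDiffeotopyReduction.lean`), and
`s = Φ₁ ∘ u⁻¹` is reached by a compactly supported diffeotopy
(`exists_compactDiffeotopy_of_straightening`); the supports are normalised to the unit disc by
`UnitBallDiffeotopyTrivial.of_compact` (`DiffeotopyTransportProofs.lean`).

Everything here is proved; there are no definitions and no named facts.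

## References

* S. Smale, *Diffeomorphisms of the 2-sphere*, Proc. Amer. Math. Soc. 10 (1959) 621–626, Thm. B.
* J. Cerf, *Sur les difféomorphismes de la sphère de dimension trois (Γ₄ = 0)*, Lecture Notes in
  Mathematics 53, Springer (1968), Appendice §5, Théorème 4 and Corollaires 1–3.
  [CerfDiffeoSphere1968]
-/

noncomputable section

open Complex Set Filter Function Metric Topology
open scoped Real NNReal Manifold ContDiff
open Literature.Analysis.ODE Literature.Topology.PlaneTopology

namespace Literature.Topology.FourManifolds

/-! ### Fibred maps with positive pivot are diffeomorphisms -/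

section Fibred

variable {E : Type*} [NormedAddCommGroup E] [NormedSpace ℝ E] [CompleteSpace E]

/-- **Fibred maps with positive pivot.** Let `e₁ ≠ 0` and `G : E → ℝ` smooth and bounded with
`1 + DG(p) e₁ > 0` everywhere. Then `p ↦ p + G(p) e₁` is a bijection of `E` and a local
diffeomorphism everywhere: on each line `p + ℝ e₁` it is `x ↦ x + G(p + x e₁)`, strictly
increasing and onto (bounded perturbation of the identity), and its derivative
`id + (DG(p) ·) e₁` is a rank-one perturbation of the identity with pivot `1 + DG(p) e₁ > 0`.
[folklore] -/
theorem bijective_isLocalDiffeomorph_add_smul {e₁ : E} (he₁ : e₁ ≠ 0) {G : E → ℝ}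
    (hG : ContDiff ℝ ∞ G) (hpos : ∀ p, 0 < 1 + fderiv ℝ G p e₁) {A : ℝ} (hbdd : ∀ p, |G p| ≤ A) :
    Bijective (fun p : E => p + G p • e₁) ∧
      IsLocalDiffeomorph 𝓘(ℝ, E) 𝓘(ℝ, E) ∞ (fun p : E => p + G p • e₁) := by
  have hGd : Differentiable ℝ G := hG.differentiable (by simp)
  -- the row maps `x ↦ x + G (p + x e₁)`
  have hrow_deriv : ∀ p x, HasDerivAt (fun x : ℝ => x + G (p + x • e₁)) (1 + fderiv ℝ G (p + x • e₁) e₁) x := by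
    intro p x
    have h1 : HasDerivAt (fun x : ℝ => p + x • e₁) e₁ x := by
      simpa using ((hasDerivAt_id x).smul_const e₁).const_add p
    exact (hasDerivAt_id x).add ((hGd _).hasFDerivAt.comp_hasDerivAt x h1)
  have hrow_mono : ∀ p, StrictMono fun x : ℝ => x + G (p + x • e₁) := fun p =>
    strictMono_of_deriv_pos fun x => by rw [(hrow_deriv p x).deriv]; exact hpos _
  have hrow_cont : ∀ p, Continuous fun x : ℝ => x + G (p + x • e₁) := fun p =>
    continuous_id.add (hG.continuous.comp (by fun_prop))
  have hrow : ∀ p x, (fun p : E => p + G p • e₁) (p + x • e₁) = p + (x + G (p + x • e₁)) • e₁ := by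
    intro p x; simp only [add_smul, add_assoc]
  refine ⟨⟨fun q q' h => ?_, fun w => ?_⟩, fun p => ?_⟩
  · -- injective
    have h1 : q + G q • e₁ = q' + G q' • e₁ := h
    set y : ℝ := G q - G q' with hy
    have hq' : q' = q + y • e₁ := by
      have h2 : q' = q + G q • e₁ - G q' • e₁ := eq_sub_of_add_eq h1.symm
      rw [h2, hy, sub_smul]; abel
    have h2 : (fun x : ℝ => x + G (q + x • e₁)) 0 = (fun x : ℝ => x + G (q + x • e₁)) y := by
      have h3 : (fun p : E => p + G p • e₁) (q + (0 : ℝ) • e₁) = (fun p : E => p + G p • e₁) (q + y • e₁) := by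
        rw [zero_smul, add_zero, ← hq']; exact h
      rw [hrow, hrow] at h3
      exact smul_left_injective ℝ he₁ (add_left_cancel h3)
    have h5 : (0 : ℝ) = y := (hrow_mono q).injective h2
    rw [hq', ← h5, zero_smul, add_zero]
  · -- surjective: solve on the row of `w`
    have hlo : (fun x : ℝ => x + G (w + x • e₁)) (-(A + 1)) < 0 := by
      have := (abs_le.1 (hbdd (w + (-(A + 1)) • e₁))).2; simp only; linarith
    have hhi : 0 < (fun x : ℝ => x + G (w + x • e₁)) (A + 1) := by
      have := (abs_le.1 (hbdd (w + (A + 1) • e₁))).1; simp only; linarith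
    obtain ⟨x, -, hx⟩ := intermediate_value_Icc (by linarith [(abs_nonneg _).trans (hbdd w)] : -(A + 1) ≤ A + 1)
      (hrow_cont w).continuousOn ⟨hlo.le, hhi.le⟩
    refine ⟨w + x • e₁, ?_⟩
    rw [hrow]
    have hx' : x + G (w + x • e₁) = 0 := hx
    rw [hx', zero_smul, add_zero]
  · -- local diffeomorphism
    have hstage : ContDiff ℝ ∞ fun p : E => p + G p • e₁ := contDiff_id.add (hG.smul contDiff_const)
    obtain ⟨L, hL⟩ := exists_continuousLinearEquiv_rankOne (fderiv ℝ G p) e₁ 1 (by rw [one_mul]; exact (hpos p).ne')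
    refine isLocalDiffeomorphAt_of_hasFDerivAt_writtenInExtChartAt (U := univ) isOpen_univ
      (mem_univ p) hstage.contMDiff.contMDiffOn (by simp) L ?_
    rw [hL, one_smul]
    exact (hasFDerivAt_id p).add ((hGd p).hasFDerivAt.smul_const e₁)

end Fibred

/-! ### The angle function of the image foliation -/

section Angle

/-- The closed exterior of the unit disc is the closure of the open exterior. [folklore] -/
theorem closure_setOf_one_lt_norm : closure {z : ℂ | 1 < ‖z‖} = {z : ℂ | 1 ≤ ‖z‖} := by
  have e1 : {z : ℂ | 1 < ‖z‖} = (closedBall (0 : ℂ) 1)ᶜ := by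
    ext z; simp [not_le]
  have e2 : {z : ℂ | 1 ≤ ‖z‖} = (ball (0 : ℂ) 1)ᶜ := by
    ext z; simp [not_lt]
  rw [e1, e2, closure_compl, _root_.interior_closedBall (0 : ℂ) one_ne_zero]

/-- The closed exterior of the unit disc in the plane is preconnected. [folklore] -/
theorem isPreconnected_setOf_one_le_norm : IsPreconnected {z : ℂ | 1 ≤ ‖z‖} := by
  rw [← closure_setOf_one_lt_norm]
  exact (isConnected_setOf_lt_norm zero_le_one).isPreconnected.closure

/-- A continuous function equal to a constant `c` on the open exterior of the unit disc equals
`c` on the closed exterior. [folklore] -/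
theorem eqOn_of_eqOn_setOf_one_lt_norm {Y : Type*} [TopologicalSpace Y] [T2Space Y] {f : ℂ → Y}
    (hf : Continuous f) {c : Y} (h : ∀ z : ℂ, 1 < ‖z‖ → f z = c) : ∀ z : ℂ, 1 ≤ ‖z‖ → f z = c := by
  have hsub : {z : ℂ | 1 < ‖z‖} ⊆ {z : ℂ | f z = c} := fun z hz => h z hz
  have hcl := closure_minimal hsub (isClosed_eq hf continuous_const)
  rw [closure_setOf_one_lt_norm] at hcl
  exact fun z hz => hcl hz

variable (s : ℂ ≃ₘ⟮𝓘(ℝ, ℂ), 𝓘(ℝ, ℂ)⟯ ℂ)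

/-- **The angle function of the image foliation.** Let `s` be a diffeomorphism of `ℂ` equal to
the identity off the closed unit disc and `F = Im ∘ s⁻¹`. There is a smooth `Θ : ℂ → ℂ`, purely
imaginary and vanishing off the disc, such that `exp Θ` is a unit vector field annihilated by
`dF` (the unit tangent field of the level curves of `F`, normalised to be `1` off the disc):
`Θ = iθ` is a continuous (hence smooth) branch of the angle of `-i ∇F/‖∇F‖`, which exists
because the plane is simply connected, normalised on the connected exterior of the disc.
[cite: CerfDiffeoSphere1968, Appendice §5, Théorème 4] -/
theorem exists_angle_of_diffeomorph (hs : ∀ z, 1 ≤ ‖z‖ → s z = z) :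
    ∃ Θ : ℂ → ℂ, ContDiff ℝ ∞ Θ ∧ (∀ z, 1 ≤ ‖z‖ → Θ z = 0) ∧ (∀ z, (Θ z).re = 0) ∧
      ∀ z, fderiv ℝ (fun w : ℂ => (s.symm w).im) z (exp (Θ z)) = 0 := by
  -- the inverse `g` and the function `F = Im ∘ g`
  have hg : ∀ z, 1 ≤ ‖z‖ → s.symm z = z := fun z hz => by
    conv_lhs => rw [← hs z hz]
    exact s.symm_apply_apply z
  have hgc : ContDiff ℝ ∞ (s.symm : ℂ → ℂ) := contMDiff_iff_contDiff.mp s.symm.contMDiff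
  have hgd : Differentiable ℝ (s.symm : ℂ → ℂ) := hgc.differentiable (by simp)
  have hFc : ContDiff ℝ ∞ fun w : ℂ => (s.symm w).im := Complex.imCLM.contDiff.comp hgc
  have hFd : ∀ z, HasFDerivAt (fun w : ℂ => (s.symm w).im) (Complex.imCLM.comp (fderiv ℝ s.symm z)) z :=
    fun z => Complex.imCLM.hasFDerivAt.comp z (hgd z).hasFDerivAt
  -- the complex gradient `W = ∂ₓF + i ∂_yF`
  set W : ℂ → ℂ := fun z => ((fderiv ℝ (fun w : ℂ => (s.symm w).im) z 1 : ℝ) : ℂ) +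
    ((fderiv ℝ (fun w : ℂ => (s.symm w).im) z I : ℝ) : ℂ) * I with hW_def
  have hWc : ContDiff ℝ ∞ W := by
    have h1 : ContDiff ℝ ∞ (fderiv ℝ fun w : ℂ => (s.symm w).im) := hFc.fderiv_right (by simp)
    exact (ofRealCLM.contDiff.comp (h1.clm_apply contDiff_const)).add
      ((ofRealCLM.contDiff.comp (h1.clm_apply contDiff_const)).mul contDiff_const)
  -- `dF(v) = Re v ∂ₓF + Im v ∂_yF`
  have hDF : ∀ z v, fderiv ℝ (fun w : ℂ => (s.symm w).im) z v =
      v.re * fderiv ℝ (fun w : ℂ => (s.symm w).im) z 1 + v.im * fderiv ℝ (fun w : ℂ => (s.symm w).im) z I := by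
    intro z v
    have e : v = v.re • (1 : ℂ) + v.im • I := by
      apply Complex.ext <;> simp
    conv_lhs => rw [e]
    rw [map_add, map_smul, map_smul, smul_eq_mul, smul_eq_mul]
  -- `W ≠ 0` (the derivative of `g` is onto)
  have hW0 : ∀ z, W z ≠ 0 := by
    intro z hz
    have h1 : fderiv ℝ (fun w : ℂ => (s.symm w).im) z 1 = 0 ∧ fderiv ℝ (fun w : ℂ => (s.symm w).im) z I = 0 := by
      have hre := congrArg re hz
      have him := congrArg im hz
      simp only [hW_def, add_re, ofReal_re, mul_re, I_re, mul_zero, ofReal_im, I_im, mul_one, sub_self,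
        add_zero, zero_re, add_im, mul_im, zero_add, zero_im] at hre him
      exact ⟨hre, him⟩
    have h2 : ∀ v, fderiv ℝ (fun w : ℂ => (s.symm w).im) z v = 0 := fun v => by
      rw [hDF, h1.1, h1.2, mul_zero, mul_zero, add_zero]
    -- but `dF = Im ∘ Dg` and `Dg` is invertible
    obtain ⟨u, hu⟩ := Diffeomorph.isUnit_fderiv s.symm z
    have h3 := h2 ((↑u⁻¹ : ℂ →L[ℝ] ℂ) I)
    rw [(hFd z).fderiv, ContinuousLinearMap.comp_apply, ← hu] at h3
    have h4 : ((↑u : ℂ →L[ℝ] ℂ)) ((↑u⁻¹ : ℂ →L[ℝ] ℂ) I) = I := by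
      rw [← ContinuousLinearMap.comp_apply, ← ContinuousLinearMap.mul_def, ← Units.val_mul,
        mul_inv_cancel, Units.val_one]
      rfl
    rw [h4] at h3
    simp at h3
  -- `W = i` off the disc
  have hWout : ∀ z, 1 ≤ ‖z‖ → W z = I := by
    refine eqOn_of_eqOn_setOf_one_lt_norm hWc.continuous fun z hz => ?_
    have hev : (fun w : ℂ => (s.symm w).im) =ᶠ[𝓝 z] fun w => w.im := by
      have hopen : IsOpen {w : ℂ | 1 < ‖w‖} := isOpen_lt continuous_const continuous_norm
      filter_upwards [hopen.mem_nhds hz] with w hw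
      rw [hg w hw.le]
    have hfd : fderiv ℝ (fun w : ℂ => (s.symm w).im) z = Complex.imCLM := by
      rw [hev.fderiv_eq]; exact Complex.imCLM.fderiv
    simp only [hW_def, hfd]
    simp
  -- the unit field `X₁ = -i W/‖W‖`
  set X₁ : ℂ → ℂ := fun z => -I * W z * (((‖W z‖)⁻¹ : ℝ) : ℂ) with hX₁_def
  have hX₁c : ContDiff ℝ ∞ X₁ := by
    refine contDiff_iff_contDiffAt.2 fun z => ?_
    have h1 : ContDiffAt ℝ ∞ (fun z => ‖W z‖) z := (hWc.contDiffAt).norm ℝ (hW0 z)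
    exact ((contDiffAt_const.mul hWc.contDiffAt).mul (ofRealCLM.contDiff.contDiffAt.comp z (h1.inv (norm_ne_zero_iff.2 (hW0 z)))))
  have hX₁norm : ∀ z, ‖X₁ z‖ = 1 := by
    intro z
    have h := norm_ne_zero_iff.2 (hW0 z)
    simp only [hX₁_def, norm_mul, norm_neg, norm_I, one_mul, norm_real, Real.norm_eq_abs, abs_inv, abs_norm]
    exact mul_inv_cancel₀ h
  have hX₁0 : ∀ z, X₁ z ≠ 0 := fun z => norm_ne_zero_iff.1 (by rw [hX₁norm]; exact one_ne_zero)
  have hX₁out : ∀ z, 1 ≤ ‖z‖ → X₁ z = 1 := by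
    intro z hz
    show -I * W z * (((‖W z‖)⁻¹ : ℝ) : ℂ) = 1
    rw [hWout z hz, norm_I, inv_one, ofReal_one, mul_one, neg_mul, I_mul_I, neg_neg]
  -- `X₁` is annihilated by `dF`
  have hX₁F : ∀ z, fderiv ℝ (fun w : ℂ => (s.symm w).im) z (X₁ z) = 0 := by
    intro z
    rw [hDF]
    have hre : (X₁ z).re = fderiv ℝ (fun w : ℂ => (s.symm w).im) z I * (‖W z‖)⁻¹ := by
      simp [hX₁_def, hW_def]
    have him : (X₁ z).im = -(fderiv ℝ (fun w : ℂ => (s.symm w).im) z 1) * (‖W z‖)⁻¹ := by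
      simp [hX₁_def, hW_def]
    rw [hre, him]
    ring
  -- a continuous logarithm `Θ₀` of `X₁`, purely imaginary, constant off the disc
  obtain ⟨Θ₀, hΘ₀c, hΘ₀e⟩ := hasLogOn_univ isSimplyConnected_univ_complex hX₁c.continuous hX₁0
  have hΘ₀c' : Continuous Θ₀ := continuousOn_univ.1 hΘ₀c
  have hΘ₀e' : ∀ z, exp (Θ₀ z) = X₁ z := fun z => hΘ₀e z (mem_univ z)
  have hΘ₀re : ∀ z, (Θ₀ z).re = 0 := by
    intro z
    have h := congrArg norm (hΘ₀e' z)
    rw [Complex.norm_exp, hX₁norm] at h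
    exact (Real.exp_eq_one_iff _).1 h
  obtain ⟨n, hn⟩ := exists_int_eq_add_of_exp_eq isPreconnected_setOf_one_le_norm (l := Θ₀)
    (m := fun _ => (0 : ℂ)) hΘ₀c'.continuousOn continuousOn_const (fun z hz => by
      rw [hΘ₀e' z, hX₁out z hz, exp_zero])
  -- the normalised logarithm
  set Θ : ℂ → ℂ := fun z => Θ₀ z - n * (2 * π * I) with hΘ_def
  have hΘe : ∀ z, exp (Θ z) = X₁ z := by
    intro z
    simp only [hΘ_def]
    rw [exp_sub, hΘ₀e' z, exp_int_mul_two_pi_mul_I, div_one]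
  have hΘout : ∀ z, 1 ≤ ‖z‖ → Θ z = 0 := by
    intro z hz
    simp only [hΘ_def]
    rw [hn z hz, zero_add, sub_self]
  have hΘre : ∀ z, (Θ z).re = 0 := by
    intro z
    simp only [hΘ_def, sub_re, hΘ₀re z]
    simp
  have hΘc : Continuous Θ := hΘ₀c'.sub continuous_const
  -- smoothness: locally `Θ` is a principal logarithm up to a constant
  have hΘsmooth : ContDiff ℝ ∞ Θ := by
    refine contDiff_iff_contDiffAt.2 fun z₀ => ?_
    have hc0 : X₁ z₀ ≠ 0 := hX₁0 z₀
    have hRc : ContDiff ℝ ∞ fun z => X₁ z / X₁ z₀ := hX₁c.div_const _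
    have hR1 : X₁ z₀ / X₁ z₀ = 1 := div_self hc0
    -- a ball on which `X₁ / X₁ z₀` is within `1` of `1`
    have hopen : IsOpen {z : ℂ | ‖X₁ z / X₁ z₀ - 1‖ < 1} :=
      isOpen_lt ((hRc.continuous.sub continuous_const).norm) continuous_const
    have hmem : z₀ ∈ {z : ℂ | ‖X₁ z / X₁ z₀ - 1‖ < 1} := by
      show ‖X₁ z₀ / X₁ z₀ - 1‖ < 1
      rw [hR1, sub_self, norm_zero]; exact one_pos
    obtain ⟨r, hr0, hr⟩ := Metric.isOpen_iff.1 hopen z₀ hmem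
    have hslit : ∀ z ∈ ball z₀ r, X₁ z / X₁ z₀ ∈ slitPlane := fun z hz => by
      have := mem_slitPlane_of_norm_lt_one (hr hz)
      simpa using this
    -- two logarithms of `X₁ / X₁ z₀` on the ball
    obtain ⟨m, hm⟩ := exists_int_eq_add_of_exp_eq (convex_ball z₀ r).isPreconnected
      (l := fun z => Θ z - Θ z₀) (m := fun z => log (X₁ z / X₁ z₀))
      ((hΘc.sub continuous_const).continuousOn)
      ((hRc.continuous.continuousOn).clog hslit) (fun z hz => by
        rw [exp_sub, hΘe, hΘe, exp_log (slitPlane_ne_zero (hslit z hz))])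
    have hev : Θ =ᶠ[𝓝 z₀] fun z => log (X₁ z / X₁ z₀) + (Θ z₀ + m * (2 * π * I)) := by
      filter_upwards [ball_mem_nhds z₀ hr0] with z hz
      have := hm z hz
      linear_combination this
    refine ContDiffAt.congr_of_eventuallyEq ?_ hev
    refine ContDiffAt.add ?_ contDiffAt_const
    have hlog : ContDiffAt ℝ ∞ log (X₁ z₀ / X₁ z₀) := by
      have := Complex.contDiffAt_log (x := X₁ z₀ / X₁ z₀) (n := ∞) (by rw [hR1]; exact one_mem_slitPlane)
      exact this.restrict_scalars ℝ
    exact hlog.comp z₀ hRc.contDiffAt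
  refine ⟨Θ, hΘsmooth, hΘout, hΘre, fun z => ?_⟩
  rw [hΘe]
  exact hX₁F z

end Angle

/-! ### Smale's theorem -/

section Main

/-- A continuous function on `ℝ` vanishing off `[-1, 1]` is bounded. [folklore] -/
theorem exists_bound_of_eq_zero_off_Icc {f : ℝ → ℝ} (hf : Continuous f) (h : ∀ c, 1 ≤ |c| → f c = 0) :
    ∃ B : ℝ, ∀ c, |f c| ≤ B := by
  obtain ⟨C, hC⟩ := isCompact_Icc.exists_bound_of_continuousOn (s := Icc (-1 : ℝ) 1) hf.continuousOn
  refine ⟨max C 0, fun c => ?_⟩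
  by_cases hc : c ∈ Icc (-1 : ℝ) 1
  · exact ((Real.norm_eq_abs _).symm.le.trans (hC c hc)).trans (le_max_left _ _)
  · rw [h c ?_, abs_zero]
    · exact le_max_right _ _
    · rw [mem_Icc, not_and_or, not_le, not_le] at hc
      rcases hc with hc | hc
      · rw [abs_of_neg (by linarith)]; linarith
      · rw [abs_of_pos (by linarith)]; linarith

/-- **Smale's theorem, unit support in, compact support out.** Every diffeomorphism of `ℂ` equal
to the identity off the closed unit disc is the time-one stage of a compactly supported
diffeotopy of `ℂ`. See the module docstring for the proof (Smale 1959, Thm. B; Cerf 1968,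
Appendice §5, Théorème 4 at `i = 0`). [cite: CerfDiffeoSphere1968, Appendice §5, Théorème 4] -/
theorem exists_compactDiffeotopy_of_eq_self (s : ℂ ≃ₘ⟮𝓘(ℝ, ℂ), 𝓘(ℝ, ℂ)⟯ ℂ)
    (hs : ∀ z, 1 ≤ ‖z‖ → s z = z) :
    ∃ D : Diffeotopy 𝓘(ℝ, ℂ) ℂ, D.stage 1 = s ∧ ∃ R : ℝ, ∀ t y, R ≤ ‖y‖ → D.toFun t y = y := by
  obtain ⟨Θ, hΘ, hΘout, hΘre, hΘF⟩ := exists_angle_of_diffeomorph s hs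
  obtain ⟨A, hA1, hA2, hA3, hA4, hA5, hA6⟩ := exists_ambientIsotopy_flowStraighten hΘ hΘout hΘre
  have hg : ∀ z, 1 ≤ ‖z‖ → s.symm z = z := fun z hz => by
    conv_lhs => rw [← hs z hz]
    exact s.symm_apply_apply z
  /- ## Step 1: the inverse stages `N τ` and their derivatives on the line `Re = 5` -/
  set N : ℝ → ℂ → ℂ := A.toDiffeotopy.invFun with hN_def
  have hNA : ∀ τ z, N τ (A.toFun τ z) = z := fun τ z => by
    have := A.toDiffeotopy.invFun_toFun τ z
    rwa [AmbientIsotopy.toDiffeotopy_toFun] at this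
  have hAN : ∀ τ w, A.toFun τ (N τ w) = w := fun τ w => by
    have := A.toDiffeotopy.toFun_invFun τ w
    rwa [AmbientIsotopy.toDiffeotopy_toFun] at this
  have hNsmooth : ContDiff ℝ ∞ (uncurry N) := A.contDiff_uncurry_invFun
  have hAsmooth : ContDiff ℝ ∞ (uncurry A.toFun) := A.contDiff_uncurry_toFun
  have hAτ : ∀ τ, ContDiff ℝ ∞ (A.toFun τ) := fun τ => hAsmooth.comp (contDiff_const.prodMk contDiff_id)
  have hNτ : ∀ τ, ContDiff ℝ ∞ (N τ) := fun τ => hNsmooth.comp (contDiff_const.prodMk contDiff_id)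
  have hN1 : ∀ τ w, 1 ≤ |w.im| → N τ w = w := fun τ w hw => by
    conv_lhs => rw [← hA1 τ w hw]
    exact hNA τ w
  have hN0 : ∀ w, N 0 w = w := fun w => by
    have h : A.toFun 0 w = w := by rw [A.map_zero]; rfl
    conv_lhs => rw [← h]
    exact hNA 0 w
  have hNline : ContDiff ℝ ∞ fun q : ℝ × ℝ => N q.1 (5 + (q.2 : ℂ) * I) :=
    hNsmooth.comp (contDiff_fst.prodMk (contDiff_const.add ((ofRealCLM.contDiff.comp contDiff_snd).mul contDiff_const)))
  have hNline_out : ∀ (τ c : ℝ), 1 ≤ |c| → N τ (5 + (c : ℂ) * I) = 5 + (c : ℂ) * I := fun τ c hc =>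
    hN1 τ _ (by simpa using hc)
  have hNre : ∀ τ c : ℝ, 5 ≤ (N τ (5 + (c : ℂ) * I)).re := fun τ c => by
    have := hA4 τ (N τ (5 + (c : ℂ) * I))
    rw [hAN] at this
    simpa using this
  -- derivatives of `N τ` at the points of the line
  have hDN : ∀ τ c : ℝ, fderiv ℝ (N τ) (5 + (c : ℂ) * I) 1 = 1 ∧ Injective (fderiv ℝ (N τ) (5 + (c : ℂ) * I)) := by
    intro τ c
    have hAz : A.toFun τ (N τ (5 + (c : ℂ) * I)) = 5 + (c : ℂ) * I := hAN τ _
    have h1 : HasFDerivAt (A.toFun τ) (fderiv ℝ (A.toFun τ) (N τ (5 + (c : ℂ) * I))) (N τ (5 + (c : ℂ) * I)) :=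
      ((hAτ τ).differentiable (by simp) _).hasFDerivAt
    have h2 : HasFDerivAt (N τ) (fderiv ℝ (N τ) (5 + (c : ℂ) * I)) (5 + (c : ℂ) * I) :=
      ((hNτ τ).differentiable (by simp) _).hasFDerivAt
    have hc1 : (fderiv ℝ (A.toFun τ) (N τ (5 + (c : ℂ) * I))).comp (fderiv ℝ (N τ) (5 + (c : ℂ) * I)) =
        ContinuousLinearMap.id ℝ ℂ := by
      have h3 := h1.comp (5 + (c : ℂ) * I) h2
      have h4 : (A.toFun τ ∘ N τ) = id := funext (hAN τ)
      rw [h4] at h3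
      exact h3.unique (hasFDerivAt_id _)
    have hc2 : (fderiv ℝ (N τ) (5 + (c : ℂ) * I)).comp (fderiv ℝ (A.toFun τ) (N τ (5 + (c : ℂ) * I))) =
        ContinuousLinearMap.id ℝ ℂ := by
      have h2' : HasFDerivAt (N τ) (fderiv ℝ (N τ) (5 + (c : ℂ) * I)) (A.toFun τ (N τ (5 + (c : ℂ) * I))) := by
        rw [hAz]; exact h2
      have h3 := h2'.comp _ h1
      have h4 : (N τ ∘ A.toFun τ) = id := funext (hNA τ)
      rw [h4] at h3
      exact h3.unique (hasFDerivAt_id _)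
    have hinjN : Injective (fderiv ℝ (N τ) (5 + (c : ℂ) * I)) := fun v v' hv => by
      have := congrArg (fderiv ℝ (A.toFun τ) (N τ (5 + (c : ℂ) * I))) hv
      rwa [← ContinuousLinearMap.comp_apply, ← ContinuousLinearMap.comp_apply, hc1] at this
    have hA1' : fderiv ℝ (A.toFun τ) (N τ (5 + (c : ℂ) * I)) 1 = 1 :=
      hA5 τ _ (by rw [hAz]; exact one_le_norm_of_re_im (Or.inl (by simp)))
    refine ⟨?_, hinjN⟩
    conv_lhs => rw [← hA1']
    rw [← ContinuousLinearMap.comp_apply, hc2]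
    rfl
  -- the `c`-derivative of `k τ c = Im N τ (5 + ci)` is `Im (DN i)`: nonzero, continuous, `1` far out, hence positive
  have hk_hasDeriv : ∀ τ c : ℝ, HasDerivAt (fun c : ℝ => (N τ (5 + (c : ℂ) * I)).im)
      ((fderiv ℝ (N τ) (5 + (c : ℂ) * I) I).im) c := by
    intro τ c
    have h1 : HasDerivAt (fun c : ℝ => (5 : ℂ) + (c : ℂ) * I) I c := by
      simpa using ((hasDerivAt_id c).ofReal_comp.mul_const I).const_add (5 : ℂ)
    have h2 : HasFDerivAt (N τ) (fderiv ℝ (N τ) (5 + (c : ℂ) * I)) (5 + (c : ℂ) * I) :=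
      ((hNτ τ).differentiable (by simp) _).hasFDerivAt
    have h3 := h2.comp_hasDerivAt c h1
    exact Complex.imCLM.hasFDerivAt.comp_hasDerivAt c h3
  have hkd_ne : ∀ τ c : ℝ, (fderiv ℝ (N τ) (5 + (c : ℂ) * I) I).im ≠ 0 := by
    intro τ c h0
    obtain ⟨hone, hinj⟩ := hDN τ c
    have e : fderiv ℝ (N τ) (5 + (c : ℂ) * I) I =
        fderiv ℝ (N τ) (5 + (c : ℂ) * I) (((fderiv ℝ (N τ) (5 + (c : ℂ) * I) I).re : ℂ)) := by
      rw [show (((fderiv ℝ (N τ) (5 + (c : ℂ) * I)) I).re : ℂ) = ((fderiv ℝ (N τ) (5 + (c : ℂ) * I)) I).re • (1 : ℂ) by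
        simp, map_smul, hone]
      apply Complex.ext <;> simp [h0]
    have := congrArg im (hinj e)
    simp at this
  have hkd_cont : ∀ τ : ℝ, Continuous fun c : ℝ => (fderiv ℝ (N τ) (5 + (c : ℂ) * I) I).im := fun τ =>
    continuous_im.comp ((((hNτ τ).continuous_fderiv (by simp)).comp (by fun_prop)).clm_apply continuous_const)
  have hkd_two : ∀ τ : ℝ, (fderiv ℝ (N τ) (5 + ((2 : ℝ) : ℂ) * I) I).im = 1 := by
    intro τ
    have hev : (fun c : ℝ => c) =ᶠ[𝓝 (2 : ℝ)] fun c : ℝ => (N τ (5 + (c : ℂ) * I)).im := by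
      filter_upwards [eventually_gt_nhds (show (1 : ℝ) < 2 by norm_num)] with c hc
      rw [hNline_out τ c (by rw [abs_of_pos (by linarith)]; exact hc.le)]
      simp
    have h1 := (hk_hasDeriv τ 2).congr_of_eventuallyEq hev
    exact h1.unique (hasDerivAt_id' (2 : ℝ))
  have hkd_pos : ∀ τ c : ℝ, 0 < (fderiv ℝ (N τ) (5 + (c : ℂ) * I) I).im := by
    intro τ c
    by_contra hle
    rw [not_lt] at hle
    rcases le_total c 2 with h | h
    · obtain ⟨x, -, hx⟩ := intermediate_value_Icc h (hkd_cont τ).continuousOn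
        (show (0 : ℝ) ∈ Icc _ _ from ⟨hle, by rw [hkd_two]; norm_num⟩)
      exact hkd_ne τ x hx
    · obtain ⟨x, -, hx⟩ := intermediate_value_Icc' h (hkd_cont τ).continuousOn
        (show (0 : ℝ) ∈ Icc _ _ from ⟨hle, by rw [hkd_two]; norm_num⟩)
      exact hkd_ne τ x hx
  /- ## Step 2: the cut-off `β(x) = χ((x - 2)/3)` and the two families of shears -/
  have hβ0 : ∀ x : ℝ, x ≤ 2 → Real.smoothTransition ((x - 2) / 3) = 0 := fun x hx =>
    Real.smoothTransition.zero_of_nonpos (by linarith)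
  have hβ1 : ∀ x : ℝ, 5 ≤ x → Real.smoothTransition ((x - 2) / 3) = 1 := fun x hx =>
    Real.smoothTransition.one_of_one_le (by linarith)
  have hβsmooth : ContDiff ℝ ∞ fun x : ℝ => Real.smoothTransition ((x - 2) / 3) :=
    Real.smoothTransition.contDiff.comp ((contDiff_id.sub contDiff_const).div_const _)
  have hβmono : Monotone fun x : ℝ => Real.smoothTransition ((x - 2) / 3) := fun x y hxy =>
    Real.smoothTransition.monotone (by linarith)
  have hβd : ∀ x : ℝ, HasDerivAt (fun x : ℝ => Real.smoothTransition ((x - 2) / 3))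
      (deriv (fun x : ℝ => Real.smoothTransition ((x - 2) / 3)) x) x := fun x =>
    ((hβsmooth.differentiable (by simp)) x).hasDerivAt
  have hβd_nn : ∀ x : ℝ, 0 ≤ deriv (fun x : ℝ => Real.smoothTransition ((x - 2) / 3)) x := fun x =>
    hβmono.deriv_nonneg
  -- the displacements: `GH τ z = β(Re z) a_τ(Im z)`, `GV τ z = β(Re z) (k_τ(Im z) - Im z)`
  set GH : ℝ → ℂ → ℝ := fun τ z => Real.smoothTransition ((z.re - 2) / 3) * ((N τ (5 + (z.im : ℂ) * I)).re - 5) with hGH_def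
  set GV : ℝ → ℂ → ℝ := fun τ z => Real.smoothTransition ((z.re - 2) / 3) * ((N τ (5 + (z.im : ℂ) * I)).im - z.im) with hGV_def
  have hGHsmooth : ContDiff ℝ ∞ (uncurry GH) := by
    refine ((hβsmooth.comp (Complex.reCLM.contDiff.comp contDiff_snd)).mul ?_)
    exact (Complex.reCLM.contDiff.comp (hNline.comp (contDiff_fst.prodMk (Complex.imCLM.contDiff.comp contDiff_snd)))).sub
      contDiff_const
  have hGVsmooth : ContDiff ℝ ∞ (uncurry GV) := by
    refine ((hβsmooth.comp (Complex.reCLM.contDiff.comp contDiff_snd)).mul ?_)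
    exact (Complex.imCLM.contDiff.comp (hNline.comp (contDiff_fst.prodMk (Complex.imCLM.contDiff.comp contDiff_snd)))).sub
      (Complex.imCLM.contDiff.comp contDiff_snd)
  have hGHτ : ∀ τ, ContDiff ℝ ∞ (GH τ) := fun τ => hGHsmooth.comp (contDiff_const.prodMk contDiff_id)
  have hGVτ : ∀ τ, ContDiff ℝ ∞ (GV τ) := fun τ => hGVsmooth.comp (contDiff_const.prodMk contDiff_id)
  -- the pivots
  have hGH_pivot : ∀ τ z, fderiv ℝ (GH τ) z 1 =
      deriv (fun x : ℝ => Real.smoothTransition ((x - 2) / 3)) z.re * ((N τ (5 + (z.im : ℂ) * I)).re - 5) := by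
    intro τ z
    have h1 : HasFDerivAt (GH τ) (fderiv ℝ (GH τ) z) (z + ((0 : ℝ) : ℂ)) := by
      rw [ofReal_zero, add_zero]; exact (((hGHτ τ).differentiable (by simp)) z).hasFDerivAt
    have h2 : HasDerivAt (fun x : ℝ => z + (x : ℂ)) 1 0 := by
      simpa using ((hasDerivAt_id (0 : ℝ)).ofReal_comp).const_add z
    have h3 := h1.comp_hasDerivAt (0 : ℝ) h2
    have h4 : HasDerivAt (fun x : ℝ => GH τ (z + (x : ℂ)))
        (deriv (fun x : ℝ => Real.smoothTransition ((x - 2) / 3)) z.re * ((N τ (5 + (z.im : ℂ) * I)).re - 5)) 0 := by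
      have e : (fun x : ℝ => GH τ (z + (x : ℂ))) =
          fun x : ℝ => Real.smoothTransition (((z.re + x) - 2) / 3) * ((N τ (5 + (z.im : ℂ) * I)).re - 5) := by
        funext x; simp [hGH_def]
      rw [e]
      have h5 : HasDerivAt (fun x : ℝ => Real.smoothTransition (((z.re + x) - 2) / 3))
          (deriv (fun x : ℝ => Real.smoothTransition ((x - 2) / 3)) z.re) 0 := by
        have := (hβd (z.re + 0)).comp (0 : ℝ) ((hasDerivAt_id' (0 : ℝ)).const_add z.re)
        rw [add_zero, mul_one] at this
        exact this
      exact h5.mul_const _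
    exact h3.unique h4
  have hGV_pivot : ∀ τ z, fderiv ℝ (GV τ) z I =
      Real.smoothTransition ((z.re - 2) / 3) * ((fderiv ℝ (N τ) (5 + (z.im : ℂ) * I) I).im - 1) := by
    intro τ z
    have h1 : HasFDerivAt (GV τ) (fderiv ℝ (GV τ) z) (z + ((0 : ℝ) : ℂ) * I) := by
      rw [ofReal_zero, zero_mul, add_zero]; exact (((hGVτ τ).differentiable (by simp)) z).hasFDerivAt
    have h2 : HasDerivAt (fun y : ℝ => z + (y : ℂ) * I) I 0 := by
      simpa using (((hasDerivAt_id (0 : ℝ)).ofReal_comp).mul_const I).const_add z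
    have h3 := h1.comp_hasDerivAt (0 : ℝ) h2
    have h4 : HasDerivAt (fun y : ℝ => GV τ (z + (y : ℂ) * I))
        (Real.smoothTransition ((z.re - 2) / 3) * ((fderiv ℝ (N τ) (5 + (z.im : ℂ) * I) I).im - 1)) 0 := by
      have e : (fun y : ℝ => GV τ (z + (y : ℂ) * I)) =
          fun y : ℝ => Real.smoothTransition ((z.re - 2) / 3) * ((N τ (5 + ((z.im + y : ℝ) : ℂ) * I)).im - (z.im + y)) := by
        funext y; simp [hGV_def]
      rw [e]
      have h5 : HasDerivAt (fun y : ℝ => (N τ (5 + ((z.im + y : ℝ) : ℂ) * I)).im)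
          ((fderiv ℝ (N τ) (5 + (z.im : ℂ) * I) I).im) 0 := by
        have := (hk_hasDeriv τ (z.im + 0)).comp (0 : ℝ) ((hasDerivAt_id' (0 : ℝ)).const_add z.im)
        rw [add_zero, mul_one] at this
        exact this
      have h6 : HasDerivAt (fun y : ℝ => z.im + y) 1 0 := (hasDerivAt_id' (0 : ℝ)).const_add z.im
      have := (h5.sub h6).const_mul (Real.smoothTransition ((z.re - 2) / 3))
      exact this
    exact h3.unique h4
  -- the shears are diffeomorphisms
  have hH : ∀ τ, Bijective (fun z : ℂ => z + GH τ z • (1 : ℂ)) ∧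
      IsLocalDiffeomorph 𝓘(ℝ, ℂ) 𝓘(ℝ, ℂ) ∞ (fun z : ℂ => z + GH τ z • (1 : ℂ)) := by
    intro τ
    have hcont : Continuous fun c : ℝ => (N τ (5 + (c : ℂ) * I)).re - 5 :=
      (continuous_re.comp (hNline.comp (contDiff_const.prodMk contDiff_id)).continuous).sub continuous_const
    obtain ⟨B, hB⟩ := exists_bound_of_eq_zero_off_Icc hcont (fun c hc => by
      show (N τ (5 + (c : ℂ) * I)).re - 5 = 0
      rw [hNline_out τ c hc]; simp)
    refine bijective_isLocalDiffeomorph_add_smul one_ne_zero (hGHτ τ) (fun z => ?_) (A := B) (fun z => ?_)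
    · rw [hGH_pivot]
      have := mul_nonneg (hβd_nn z.re) (sub_nonneg.2 (hNre τ z.im))
      linarith
    · simp only [hGH_def]
      rw [abs_mul, abs_of_nonneg (Real.smoothTransition.nonneg _)]
      exact (mul_le_of_le_one_left (abs_nonneg _) (Real.smoothTransition.le_one _)).trans (hB z.im)
  have hV : ∀ τ, Bijective (fun z : ℂ => z + GV τ z • I) ∧
      IsLocalDiffeomorph 𝓘(ℝ, ℂ) 𝓘(ℝ, ℂ) ∞ (fun z : ℂ => z + GV τ z • I) := by
    intro τ
    have hcont : Continuous fun c : ℝ => (N τ (5 + (c : ℂ) * I)).im - c :=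
      (continuous_im.comp (hNline.comp (contDiff_const.prodMk contDiff_id)).continuous).sub continuous_id
    obtain ⟨B, hB⟩ := exists_bound_of_eq_zero_off_Icc hcont (fun c hc => by
      show (N τ (5 + (c : ℂ) * I)).im - c = 0
      rw [hNline_out τ c hc]; simp)
    refine bijective_isLocalDiffeomorph_add_smul I_ne_zero (hGVτ τ) (fun z => ?_) (A := B) (fun z => ?_)
    · rw [hGV_pivot]
      have h0 := Real.smoothTransition.nonneg ((z.re - 2) / 3)
      have h1 := Real.smoothTransition.le_one ((z.re - 2) / 3)
      have h2 := hkd_pos τ z.im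
      have h3 := mul_nonneg h0 h2.le
      rcases h1.lt_or_eq with hlt | heq
      · nlinarith
      · rw [heq]; linarith
    · simp only [hGV_def]
      rw [abs_mul, abs_of_nonneg (Real.smoothTransition.nonneg _)]
      exact (mul_le_of_le_one_left (abs_nonneg _) (Real.smoothTransition.le_one _)).trans (hB z.im)
  /- ## Step 3: the corrected ambient isotopy `Φ τ = A τ ∘ V τ ∘ H τ` -/
  have hHjoint : ContDiff ℝ ∞ fun q : ℝ × ℂ => q.2 + GH q.1 q.2 • (1 : ℂ) :=
    contDiff_snd.add (hGHsmooth.smul contDiff_const)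
  have hVjoint : ContDiff ℝ ∞ fun q : ℝ × ℂ => q.2 + GV q.1 q.2 • I :=
    contDiff_snd.add (hGVsmooth.smul contDiff_const)
  have hΦjoint : ContDiff ℝ ∞ fun q : ℝ × ℂ =>
      A.toFun q.1 ((fun w : ℂ => w + GV q.1 w • I) (q.2 + GH q.1 q.2 • (1 : ℂ))) := by
    have h1 : ContDiff ℝ ∞ fun q : ℝ × ℂ => ((q.1, (q.2 + GH q.1 q.2 • (1 : ℂ)) + GV q.1 (q.2 + GH q.1 q.2 • (1 : ℂ)) • I) : ℝ × ℂ) :=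
      contDiff_fst.prodMk (hVjoint.comp (contDiff_fst.prodMk hHjoint))
    exact hAsmooth.comp h1
  have hΦ0 : (fun z : ℂ => A.toFun 0 ((fun w : ℂ => w + GV 0 w • I) (z + GH 0 z • (1 : ℂ)))) = id := by
    funext z
    have h1 : GH 0 z = 0 := by simp only [hGH_def]; rw [hN0]; simp
    have h2 : ∀ w, GV 0 w = 0 := fun w => by simp only [hGV_def]; rw [hN0]; simp
    simp only [h1, h2, zero_smul, add_zero, A.map_zero, id]
  set Φ : AmbientIsotopy 𝓘(ℝ, ℂ) ℂ :=
    { toFun := fun τ z => A.toFun τ ((fun w : ℂ => w + GV τ w • I) (z + GH τ z • (1 : ℂ)))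
      contMDiff := contMDiff_prod_self_of_contDiff hΦjoint
      bijective := fun τ => (A.bijective τ).comp ((hV τ).1.comp (hH τ).1)
      isLocalDiffeomorph := fun τ x => IsLocalDiffeomorphAt.comp (hf := (hH τ).2 x)
        (hg := IsLocalDiffeomorphAt.comp (hf := (hV τ).2 _) (hg := A.isLocalDiffeomorph τ _))
      map_zero := hΦ0 } with hΦ_def
  -- compact support: `Φ τ = id` off the ball of radius `6`
  have hsupp : ∀ (τ : ℝ) (z : ℂ), 6 ≤ ‖z‖ → Φ.toFun τ z = z := by
    intro τ z hz
    show A.toFun τ ((z + GH τ z • (1 : ℂ)) + GV τ (z + GH τ z • (1 : ℂ)) • I) = z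
    have hsplit : 1 ≤ |z.im| ∨ (|z.im| < 1 ∧ 5 ≤ |z.re|) := by
      by_cases h : 1 ≤ |z.im|
      · exact Or.inl h
      · right
        refine ⟨not_le.1 h, ?_⟩
        have := norm_le_abs_re_add_abs_im z
        linarith [not_le.1 h]
    rcases hsplit with him | ⟨him, hre⟩
    · -- rows off the disc
      have h1 : GH τ z = 0 := by simp only [hGH_def]; rw [hNline_out τ z.im him]; simp
      have h2 : GV τ z = 0 := by simp only [hGV_def]; rw [hNline_out τ z.im him]; simp
      rw [h1, zero_smul, add_zero, h2, zero_smul, add_zero]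
      exact hA1 τ z him
    · rcases abs_cases z.re with ⟨habs, -⟩ | ⟨habs, -⟩
      · -- far right: `Re z ≥ 5`
        rw [habs] at hre
        have hβz : Real.smoothTransition ((z.re - 2) / 3) = 1 := hβ1 _ hre
        have hGH : GH τ z = (N τ (5 + (z.im : ℂ) * I)).re - 5 := by simp only [hGH_def]; rw [hβz, one_mul]
        have hre' : (z + GH τ z • (1 : ℂ)).re = z.re + ((N τ (5 + (z.im : ℂ) * I)).re - 5) := by
          rw [hGH]; simp
        have him' : (z + GH τ z • (1 : ℂ)).im = z.im := by simp
        have hβz' : Real.smoothTransition (((z + GH τ z • (1 : ℂ)).re - 2) / 3) = 1 :=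
          hβ1 _ (by rw [hre']; linarith [hNre τ z.im])
        have hGV : GV τ (z + GH τ z • (1 : ℂ)) = (N τ (5 + (z.im : ℂ) * I)).im - z.im := by
          simp only [hGV_def]; rw [hβz', one_mul, him']
        -- the corrected point is `N τ (5 + ci) + (Re z - 5)`
        have hpt : (z + GH τ z • (1 : ℂ)) + GV τ (z + GH τ z • (1 : ℂ)) • I =
            N τ (5 + (z.im : ℂ) * I) + ((z.re - 5 : ℝ) : ℂ) := by
          apply Complex.ext
          · rw [add_re, hre']; simp; ring
          · rw [add_im, hGV, him']; simp
        rw [hpt]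
        have hz5 : 1 ≤ (A.toFun τ (N τ (5 + (z.im : ℂ) * I))).re := by rw [hAN]; simp
        rw [hA3 τ _ _ (by linarith) hz5, hAN]
        apply Complex.ext <;> simp
      · -- far left: `Re z ≤ -5`
        have hre5 : z.re ≤ -5 := by linarith
        have hβz : Real.smoothTransition ((z.re - 2) / 3) = 0 := hβ0 _ (by linarith)
        have h1 : GH τ z = 0 := by simp only [hGH_def]; rw [hβz, zero_mul]
        have h2 : GV τ z = 0 := by simp only [hGV_def]; rw [hβz, zero_mul]
        rw [h1, zero_smul, add_zero, h2, zero_smul, add_zero]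
        exact hA2 τ z (by linarith)
  /- ## Step 4: `F ∘ Φ₁ = Im`, and the conclusion -/
  have hF : Differentiable ℝ fun w : ℂ => (s.symm w).im :=
    (Complex.imCLM.contDiff.comp (contMDiff_iff_contDiff.mp s.symm.contMDiff)).differentiable (by simp)
  have hFout : ∀ w : ℂ, 1 ≤ ‖w‖ → (fun w : ℂ => (s.symm w).im) w = w.im := fun w hw => by
    show (s.symm w).im = w.im
    rw [hg w hw]
  have hk1 : ∀ c : ℝ, (N 1 (5 + (c : ℂ) * I)).im = c := by
    intro c
    have h1 := hA6 (fun w : ℂ => (s.symm w).im) hF hΘF hFout (N 1 (5 + (c : ℂ) * I))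
    rw [hAN] at h1
    have h3 : (s.symm (5 + (c : ℂ) * I)).im = (N 1 (5 + (c : ℂ) * I)).im := h1
    rw [hg _ (one_le_norm_of_re_im (Or.inl (by simp)))] at h3
    simp at h3
    exact h3.symm
  have hstr : ∀ p : ℂ, ∃ r : ℝ, s.symm ((Φ.toDiffeomorph 1) p) = p + r • (1 : ℂ) := by
    intro p
    have hV1 : GV 1 (p + GH 1 p • (1 : ℂ)) = 0 := by
      simp only [hGV_def]; rw [hk1]; simp
    have hΦ1 : (Φ.toDiffeomorph 1) p = A.toFun 1 (p + GH 1 p • (1 : ℂ)) := by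
      rw [AmbientIsotopy.coe_toDiffeomorph]
      show A.toFun 1 ((p + GH 1 p • (1 : ℂ)) + GV 1 (p + GH 1 p • (1 : ℂ)) • I) = _
      rw [hV1, zero_smul, add_zero]
    have him : (s.symm ((Φ.toDiffeomorph 1) p)).im = p.im := by
      rw [hΦ1]
      have h2 : (s.symm (A.toFun 1 (p + GH 1 p • (1 : ℂ)))).im = (p + GH 1 p • (1 : ℂ)).im :=
        hA6 (fun w : ℂ => (s.symm w).im) hF hΘF hFout _
      rw [h2, add_im, Complex.smul_im, one_im, smul_zero, add_zero]
    refine ⟨(s.symm ((Φ.toDiffeomorph 1) p)).re - p.re, ?_⟩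
    apply Complex.ext
    · simp
    · rw [him]; simp
  exact exists_compactDiffeotopy_of_straightening s (Φ.toDiffeomorph 1) one_ne_zero hs
    ⟨Φ.toDiffeotopy, Φ.toDiffeotopy_stage 1, 6, fun t y hy => by
      rw [AmbientIsotopy.toDiffeotopy_toFun]; exact hsupp t y hy⟩ hstr

/-- **Smale's theorem, radius-free form**: `CompactDiffeotopyTrivial ℂ` — every compactly
supported diffeomorphism of the plane is the time-one stage of a compactly supported diffeotopy
(conjugate the support into the unit disc by a homothety). [cite: CerfDiffeoSphere1968, Appendice §5, Théorème 4] -/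
theorem compactDiffeotopyTrivial_complex : CompactDiffeotopyTrivial ℂ := by
  intro s R hs
  set ρ : ℝ := max R 1 with hρ
  have hρ0 : 0 < ρ := lt_of_lt_of_le one_pos (le_max_right _ _)
  have hs₁ : ∀ y : ℂ, ρ ≤ ‖y‖ → s y = y := fun y hy => hs y ((le_max_left _ _).trans hy)
  set δ := homothetyDiffeomorph (E := ℂ) ρ hρ0.ne' with hδ
  set s' := δ.trans (s.trans δ.symm) with hs'
  have hs'₁ : ∀ y : ℂ, 1 ≤ ‖y‖ → s' y = y := by
    intro y hy
    have hy' : ρ ≤ ‖ρ • y‖ := by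
      rw [norm_smul, Real.norm_of_nonneg hρ0.le]; nlinarith
    simp only [hs', Diffeomorph.coe_trans, comp_apply, hδ, homothetyDiffeomorph_apply]
    rw [hs₁ _ hy', homothetyDiffeomorph_symm_apply, inv_smul_smul₀ hρ0.ne']
  obtain ⟨D', hD'1, R', hD'⟩ := exists_compactDiffeotopy_of_eq_self s' hs'₁
  refine ⟨D'.pushforward δ, ?_, ρ * |R'| + ρ, fun t y hy => ?_⟩
  · rw [Diffeotopy.pushforward_stage, hD'1, hs']
    ext y
    simp
  · have hy' : R' ≤ ‖ρ⁻¹ • y‖ := by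
      rw [norm_smul, norm_inv, Real.norm_of_nonneg hρ0.le, le_inv_mul_iff₀ hρ0]
      have : ρ * R' ≤ ρ * |R'| := mul_le_mul_of_nonneg_left (le_abs_self _) hρ0.le
      linarith
    simp only [Diffeotopy.pushforward_toFun, hδ, homothetyDiffeomorph_apply, homothetyDiffeomorph_symm_apply]
    rw [hD' t _ hy', smul_inv_smul₀ hρ0.ne']

/-- **Smale's theorem** (S. Smale, Proc. AMS 10 (1959), Thm. B at `π₀`; Cerf 1968, Appendice
§5, Théorème 4 at `i = 0`): `π₀` of the group of diffeomorphisms of the plane supported in the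
closed unit disc is trivial — every such diffeomorphism is the time-one stage of a diffeotopy of
the plane all of whose stages are supported in the closed unit disc.
[cite: CerfDiffeoSphere1968, Appendice §5, Théorème 4] -/
theorem unitBallDiffeotopyTrivial_complex : UnitBallDiffeotopyTrivial ℂ :=
  UnitBallDiffeotopyTrivial.of_compact compactDiffeotopyTrivial_complex

/-- **Smale's theorem for `ℝ²`**: `UnitBallDiffeotopyTrivial (EuclideanSpace ℝ (Fin 2))`, the
hypothesis `hK` of the tree's `n = 2` instances of Cerf's Proposition 4 (transport of the
complex statement along `ℂ ≃ ℝ²`). [cite: CerfDiffeoSphere1968, Appendice §5, Théorème 4] -/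
theorem unitBallDiffeotopyTrivial_euclideanSpace_two : UnitBallDiffeotopyTrivial (EuclideanSpace ℝ (Fin 2)) :=
  UnitBallDiffeotopyTrivial.of_continuousLinearEquiv
    Complex.orthonormalBasisOneI.repr.toContinuousLinearEquiv unitBallDiffeotopyTrivial_complex

/-- **Cerf's Proposition 4 at `i = 0`, `n = 2`, unconditionally**: every diffeomorphism of the
`2`-sphere is diffeotopic to the identity or to a reflection (`π₀ O(3) ↠ π₀ Diff(S²)`; Cerf 1968,
Appendice §5, Corollaire 2 at `i = 0`). [cite: CerfDiffeoSphere1968, Appendice §5, Théorème 4, Corollaire 2] -/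
theorem Diffeomorph.isDiffeotopicToId_or_isDiffeotopic_sphereReflection_two
    (v : Metric.sphere (0 : EuclideanSpace ℝ (Fin 3)) 1)
    (φ : (Metric.sphere (0 : EuclideanSpace ℝ (Fin 3)) 1) ≃ₘ⟮𝓡 2, 𝓡 2⟯ (Metric.sphere (0 : EuclideanSpace ℝ (Fin 3)) 1)) :
    Diffeomorph.IsDiffeotopicToId φ ∨ Diffeomorph.IsDiffeotopic (sphereReflection v) φ :=
  Diffeomorph.isDiffeotopicToId_or_isDiffeotopic_sphereReflection_of_compactDiffeotopyTrivial
    (CompactDiffeotopyTrivial.of_unitBall unitBallDiffeotopyTrivial_euclideanSpace_two) v φ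

/-- **`Γ₃ = 0`** (Cerf 1968, Appendice §5, Corollaire 3; originally Smale and Munkres): every
diffeomorphism of `S²` extends to a diffeomorphism of the closed `3`-disc.
[cite: CerfDiffeoSphere1968, Appendice §5, Théorème 4, Corollaire 3] -/
theorem extendsOverBall_two
    (φ : (Metric.sphere (0 : EuclideanSpace ℝ (Fin 3)) 1) ≃ₘ⟮𝓡 2, 𝓡 2⟯ (Metric.sphere (0 : EuclideanSpace ℝ (Fin 3)) 1)) :
    ExtendsOverBall 2 φ :=
  extendsOverBall_of_dichotomy (sphereBasePoint 2)
    (Diffeomorph.isDiffeotopicToId_or_isDiffeotopic_sphereReflection_two (sphereBasePoint 2)) φ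

/-- **Every twisted `3`-sphere `D³ ∪_φ D³` is diffeomorphic to the round `S³`** (`Γ₃ = 0` with
the gluing uniqueness of `BallGluingUniqueness.lean`). [folklore] -/
theorem TwistedSphere.nonempty_diffeomorph_sphere_three
    {φ : (Metric.sphere (0 : EuclideanSpace ℝ (Fin 3)) 1) ≃ₘ⟮𝓡 2, 𝓡 2⟯ (Metric.sphere (0 : EuclideanSpace ℝ (Fin 3)) 1)}
    (T : TwistedSphere 2 φ) :
    Nonempty (T.carrier ≃ₘ⟮𝓡 3, 𝓡 3⟯ (Metric.sphere (0 : EuclideanSpace ℝ (Fin 4)) 1)) :=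
  T.nonempty_diffeomorph_sphere_of_extendsOverBall'' (extendsOverBall_two φ)

end Main

end Literature.Topology.FourManifolds
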